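import Literature.Computability.Complexity.TM2PassThrough
import HarnessLib

/-!
# The coin loop: running a polynomial-time machine round after round in front of a coin stream

Toolkit for `TimeBounds.lean` / `Literature/Computability/FineGrained/` (randomized exponential-
time algorithms in the format `KSATInBPExpTime` of `SatAlgorithms.lean`: one `TM2` machine over
`Bool` reading `boolPair (code of the instance) (coin string)`). A bounded-error algorithm that
repeats a polynomial-time trial `I = 2^{δn}` times, each trial consuming the next block of coins,
must run in time `I · poly` — linear in the number of rounds, although the coin string still on
the stack is exponentially long. None of the tree's loop machines does this (`TM2Iterate`,
`TM2While`, `LoopUntilFlag` move the whole word between rounds; `TM2PassThrough` runs one round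
in front of an untouched suffix but does not loop). This file extends the pass-through machine of
`TM2PassThrough.lean` (whose stack layout, register and counter arithmetic it reuses) by an
initial reader for the instance code and a flag test closing the loop:

* `TM2CoinLoop.loopTM M` / `loopAux Mx` — stacks `M.K ⊕ Aux` (`MAIN` = input = output stack),
  labels `M.Λ ⊕ Ctrl`. Protocol on `MAIN`:
  - start (`pr1`/`pr2t`/`pr2f`): the input is `boolPair x σ`; the doubled bits of `x` are
    collected and `M` is run on `x` (`ld`), its output `w` pushed back on top of `σ`
    (`out1`/`out2`), then `test`;
  - `test` pops the first symbol of `MAIN`: `true` — halt, the rest of `MAIN` is the output;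
    `false` — a round: the pass-through protocol `rd1 … out2` of `TM2PassThrough.lean` (read the
    header `passHdr n`, pop `n` further symbols `s`, run `M` on `s`, push `M(s)` back), then
    `test` again.
  So if `M` answers `x` with `0 · passHdr(|a₀| + |c₀|) · a₀` and each round input `aⱼ ++ cⱼ`
  (`cⱼ` = the next `|cⱼ|` coins) with `0 · passHdr(|aⱼ₊₁| + |cⱼ₊₁|) · aⱼ₊₁`, until a round
  answers `1 · y`, the loop machine maps `boolPair x (c₀ c₁ ⋯ c_J τ)` to `y ++ τ`;
* `TM2CoinLoop.loopAux_outputsWithin` — **main result**: … within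
  `initPoly p D |x| + ∑_{j ≤ J} (passPoly p D (|aⱼ| + |cⱼ|) + 1)` steps (`p` the time
  polynomial of `Mx`, `D` its push bound): the cost is the sum of the rounds, independent of the
  coins not yet read.

## References

* S. Arora, B. Barak, *Computational Complexity: A Modern Approach*, CUP 2009, §1.3 (machines
  running machines as subroutines; counters), Def. 7.1 (probabilistic machines read a random
  tape), §7.4.1 (error reduction by repetition: the running time is the number of repetitions
  times the cost of one). doi:10.1017/cbo9780511804090
* Mathlib, `Mathlib/Computability/TuringMachine/Computable.lean` (`FinTM2`, `initList`,
  `haltList`, `TM2OutputsInTime`).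
-/

namespace Literature.Computability.Complexity

namespace TM2CoinLoop

open Turing StateTransition Function TM2Comp TM2Pass _root_.Computability
open TM2Iter (ReachesIn reachesIn_of_outputsWithin outputsWithin_of_reachesIn)

/-- The control labels of the coin-loop machine: the prefix reader `pr1`, `pr2t`, `pr2f`, the
flag test `test`, and the eleven labels of the pass-through protocol. [folklore] -/
inductive Ctrl
  | pr1
  | pr2t
  | pr2f
  | test
  | rd1
  | rd2t
  | rd2f
  | dec
  | rf
  | mv
  | cln
  | ld
  | out1
  | out2
  | fin
  deriving DecidableEq, Fintype

section Machine

variable {K : Type} {G : K → Type} {Λ σ : Type}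

/-- Translation of the statements of `M`: act on the `inl` stacks and the first state
component; `halt` becomes a jump to the control label `out1`. [folklore] -/
def trStmt : TM2.Stmt G Λ σ → TM2.Stmt (PassΓ G) (Λ ⊕ Ctrl) (St σ)
  | TM2.Stmt.push k f q => TM2.Stmt.push (Sum.inl k) (fun s => f s.1) (trStmt q)
  | TM2.Stmt.peek k f q => TM2.Stmt.peek (Sum.inl k) (fun s x => (f s.1 x, s.2)) (trStmt q)
  | TM2.Stmt.pop k f q => TM2.Stmt.pop (Sum.inl k) (fun s x => (f s.1 x, s.2)) (trStmt q)
  | TM2.Stmt.load f q => TM2.Stmt.load (fun s => (f s.1, s.2)) (trStmt q)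
  | TM2.Stmt.branch p q₁ q₂ => TM2.Stmt.branch (fun s => p s.1) (trStmt q₁) (trStmt q₂)
  | TM2.Stmt.goto l => TM2.Stmt.goto fun s => Sum.inl (l s.1)
  | TM2.Stmt.halt => TM2.Stmt.goto fun _ => Sum.inr Ctrl.out1

/-- Configuration of the loop machine while `M` runs (auxiliary stacks empty except `MAIN`,
which holds the untouched suffix `mn`). [folklore] -/
def cfgM (c : TM2.Cfg G Λ σ) (mn : List Bool) : TM2.Cfg (PassΓ G) (Λ ⊕ Ctrl) (St σ) :=
  ⟨some (c.l.elim (Sum.inr Ctrl.out1) Sum.inl), (c.var, none), mkStk c.stk mn [] [] []⟩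

/-- One statement of `M` is simulated exactly by its translation. [folklore] -/
theorem stepAux_trStmt [DecidableEq K] (q : TM2.Stmt G Λ σ) (v : σ) (S : ∀ k, List (G k))
    (mn : List Bool) :
    TM2.stepAux (trStmt q) (v, none) (mkStk S mn [] [] []) = cfgM (TM2.stepAux q v S) mn := by
  induction q generalizing v S with
  | push k f q ih =>
    simp only [trStmt, TM2.stepAux]
    rw [← ih, mkStk_inl, mkStk_update_inl]
  | peek k f q ih => simp only [trStmt, TM2.stepAux]; exact ih _ _
  | pop k f q ih =>
    simp only [trStmt, TM2.stepAux]
    rw [← ih, mkStk_inl, mkStk_update_inl]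
  | load f q ih => simp only [trStmt, TM2.stepAux]; exact ih _ _
  | branch p q₁ q₂ ih₁ ih₂ =>
    simp only [trStmt, TM2.stepAux]
    cases p v
    · exact ih₂ _ _
    · exact ih₁ _ _
  | goto l => rfl
  | halt => rfl

variable (k₀ k₁ : K) (eIn : G k₀ ≃ Bool) (eOut : G k₁ ≃ Bool) (main : Λ) (init : σ)

/-- Jump to a control label after resetting the register. [folklore] -/
abbrev jmp (c : Ctrl) : TM2.Stmt (PassΓ G) (Λ ⊕ Ctrl) (St σ) :=
  TM2.Stmt.load rst <| TM2.Stmt.goto fun _ => Sum.inr c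

/-- The control statements of the coin-loop machine: the prefix reader (`pr1`, `pr2t`, `pr2f`:
doubled bits go to `TMP`, the separator `01` opens `ld`), the flag test (`test`), and the
pass-through protocol of `TM2PassThrough.lean` with `out2` now continuing at `test`.
[folklore] -/
def ctrlStmt : Ctrl → TM2.Stmt (PassΓ G) (Λ ⊕ Ctrl) (St σ)
  | Ctrl.pr1 =>
      TM2.Stmt.pop (Sum.inr Aux.MAIN) (fun v a => (v.1, a)) <|
        TM2.Stmt.branch (fun v => v.2.isNone) (jmp Ctrl.fin) <|
          TM2.Stmt.branch (fun v => bget v.2) (jmp Ctrl.pr2t) (jmp Ctrl.pr2f)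
  | Ctrl.pr2t =>
      TM2.Stmt.pop (Sum.inr Aux.MAIN) (fun v a => (v.1, a)) <|
        TM2.Stmt.branch (fun v => v.2.isNone) (jmp Ctrl.fin) <|
          TM2.Stmt.branch (fun v => bget v.2)
            (TM2.Stmt.push (Sum.inr Aux.TMP) (fun _ => true) <| jmp Ctrl.pr1)
            (jmp Ctrl.fin)
  | Ctrl.pr2f =>
      TM2.Stmt.pop (Sum.inr Aux.MAIN) (fun v a => (v.1, a)) <|
        TM2.Stmt.branch (fun v => v.2.isNone) (jmp Ctrl.fin) <|
          TM2.Stmt.branch (fun v => bget v.2) (jmp Ctrl.ld)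
            (TM2.Stmt.push (Sum.inr Aux.TMP) (fun _ => false) <| jmp Ctrl.pr1)
  | Ctrl.test =>
      TM2.Stmt.pop (Sum.inr Aux.MAIN) (fun v a => (v.1, a)) <|
        TM2.Stmt.branch (fun v => v.2.isNone) (jmp Ctrl.fin) <|
          TM2.Stmt.branch (fun v => bget v.2) (jmp Ctrl.fin) (jmp Ctrl.rd1)
  | Ctrl.rd1 =>
      TM2.Stmt.pop (Sum.inr Aux.MAIN) (fun v a => (v.1, a)) <|
        TM2.Stmt.branch (fun v => v.2.isNone) (jmp Ctrl.fin) <|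
          TM2.Stmt.branch (fun v => bget v.2) (jmp Ctrl.rd2t) (jmp Ctrl.rd2f)
  | Ctrl.rd2t =>
      TM2.Stmt.pop (Sum.inr Aux.MAIN) (fun v a => (v.1, a)) <|
        TM2.Stmt.branch (fun v => v.2.isNone) (jmp Ctrl.fin) <|
          TM2.Stmt.branch (fun v => bget v.2)
            (TM2.Stmt.push (Sum.inr Aux.CNT) (fun _ => true) <| jmp Ctrl.rd1)
            (jmp Ctrl.fin)
  | Ctrl.rd2f =>
      TM2.Stmt.pop (Sum.inr Aux.MAIN) (fun v a => (v.1, a)) <|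
        TM2.Stmt.branch (fun v => v.2.isNone) (jmp Ctrl.fin) <|
          TM2.Stmt.branch (fun v => bget v.2) (jmp Ctrl.dec)
            (TM2.Stmt.push (Sum.inr Aux.CNT) (fun _ => false) <| jmp Ctrl.rd1)
  | Ctrl.dec =>
      TM2.Stmt.pop (Sum.inr Aux.CNT) (fun v a => (v.1, a)) <|
        TM2.Stmt.branch (fun v => v.2.isNone) (jmp Ctrl.cln) <|
          TM2.Stmt.branch (fun v => bget v.2)
            (TM2.Stmt.push (Sum.inr Aux.CNT) (fun _ => false) <| jmp Ctrl.rf)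
            (TM2.Stmt.push (Sum.inr Aux.MRK) (fun _ => ()) <| jmp Ctrl.dec)
  | Ctrl.rf =>
      TM2.Stmt.pop (Sum.inr Aux.MRK) (fun v a => (v.1, a.map fun _ => true)) <|
        TM2.Stmt.branch (fun v => v.2.isNone) (jmp Ctrl.mv)
          (TM2.Stmt.push (Sum.inr Aux.CNT) (fun _ => true) <| jmp Ctrl.rf)
  | Ctrl.mv =>
      TM2.Stmt.pop (Sum.inr Aux.MAIN) (fun v a => (v.1, a)) <|
        TM2.Stmt.branch (fun v => v.2.isNone) (jmp Ctrl.fin)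
          (TM2.Stmt.push (Sum.inr Aux.TMP) (fun v => bget v.2) <| jmp Ctrl.dec)
  | Ctrl.cln =>
      TM2.Stmt.pop (Sum.inr Aux.MRK) (fun v a => (v.1, a.map fun _ => true)) <|
        TM2.Stmt.branch (fun v => v.2.isNone) (jmp Ctrl.ld) (jmp Ctrl.cln)
  | Ctrl.ld =>
      TM2.Stmt.pop (Sum.inr Aux.TMP) (fun v a => (v.1, a)) <|
        TM2.Stmt.branch (fun v => v.2.isNone)
          (TM2.Stmt.load rst <| TM2.Stmt.goto fun _ => Sum.inl main)
          (TM2.Stmt.push (Sum.inl k₀) (fun v => eIn.symm (bget v.2)) <| jmp Ctrl.ld)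
  | Ctrl.out1 =>
      TM2.Stmt.pop (Sum.inl k₁) (fun v a => (v.1, a.map eOut)) <|
        TM2.Stmt.branch (fun v => v.2.isNone) (jmp Ctrl.out2)
          (TM2.Stmt.push (Sum.inr Aux.TMP) (fun v => bget v.2) <| jmp Ctrl.out1)
  | Ctrl.out2 =>
      TM2.Stmt.pop (Sum.inr Aux.TMP) (fun v a => (v.1, a)) <|
        TM2.Stmt.branch (fun v => v.2.isNone) (jmp Ctrl.test)
          (TM2.Stmt.push (Sum.inr Aux.MAIN) (fun v => bget v.2) <| jmp Ctrl.out2)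
  | Ctrl.fin => TM2.Stmt.load (fun _ => (init, none)) TM2.Stmt.halt

end Machine

/-! ### Bundling -/

section Bundled

variable (M : FinTM2)

/-- Configurations with a reset register. [folklore] -/
def cfg (l : Option (M.Λ ⊕ Ctrl)) (v : M.σ) (S : ∀ k, List (M.Γ k)) (mn t c : List Bool)
    (mk : List Unit) : TM2.Cfg (PassΓ M.Γ) (M.Λ ⊕ Ctrl) (St M.σ) :=
  ⟨l, (v, none), mkStk S mn t c mk⟩

/-- The (unbundled) type of configurations of the loop machine. [folklore] -/
abbrev LCfg : Type := TM2.Cfg (PassΓ M.Γ) (M.Λ ⊕ Ctrl) (St M.σ)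

variable (eIn : M.Γ M.k₀ ≃ Bool) (eOut : M.Γ M.k₁ ≃ Bool)

/-- **The coin-loop machine** of a bundled TM2 machine `M` over `Bool`: stacks `M.K ⊕ Aux` with
input stack = output stack = `inr MAIN`, labels `M.Λ ⊕ Ctrl` (main label `pr1`), states
`M.σ × Option Bool`. [cite: AroraBarak2009, §7.4.1 (repetition) and §1.3] -/
noncomputable def loopTM : FinTM2 :=
  letI := M.kFin; letI := M.ΛFin; letI := M.σFin
  { K := M.K ⊕ Aux
    k₀ := Sum.inr Aux.MAIN
    k₁ := Sum.inr Aux.MAIN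
    Γ := PassΓ M.Γ
    Λ := M.Λ ⊕ Ctrl
    main := Sum.inr Ctrl.pr1
    σ := St M.σ
    initialState := (M.initialState, none)
    Γk₀Fin := (inferInstance : Fintype Bool)
    m := fun l => match l with
      | Sum.inl l => trStmt (M.m l)
      | Sum.inr c => ctrlStmt M.k₀ M.k₁ eIn eOut M.main M.initialState c }

/-- A step at a control label, unbundled. [folklore] -/
theorem step_inr (c : Ctrl) (var : St M.σ) (stk : ∀ j, List (PassΓ M.Γ j)) :
    (loopTM M eIn eOut).step
        (⟨some (Sum.inr c), var, stk⟩ : TM2.Cfg (PassΓ M.Γ) (M.Λ ⊕ Ctrl) (St M.σ)) =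
      some (TM2.stepAux (ctrlStmt M.k₀ M.k₁ eIn eOut M.main M.initialState c) var stk) :=
  rfl

/-- A step at a label of `M`, unbundled. [folklore] -/
theorem step_inl (l : M.Λ) (var : St M.σ) (stk : ∀ j, List (PassΓ M.Γ j)) :
    (loopTM M eIn eOut).step
        (⟨some (Sum.inl l), var, stk⟩ : TM2.Cfg (PassΓ M.Γ) (M.Λ ⊕ Ctrl) (St M.σ)) =
      some (TM2.stepAux (trStmt (M.m l)) var stk) :=
  rfl

/-! ### Single steps of the control labels -/

section Steps

variable (v : M.σ) (S : ∀ k, List (M.Γ k)) (mn t c : List Bool) (mk : List Unit)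

/-- `pr1` on `true`. [folklore] -/
theorem step_pr1_true :
    (loopTM M eIn eOut).step (cfg M (some (Sum.inr Ctrl.pr1)) v S (true :: mn) t c mk) =
      some (cfg M (some (Sum.inr Ctrl.pr2t)) v S mn t c mk) := by
  rw [cfg, step_inr]; simp [ctrlStmt, rst, bget, cfg]

/-- `pr1` on `false`. [folklore] -/
theorem step_pr1_false :
    (loopTM M eIn eOut).step (cfg M (some (Sum.inr Ctrl.pr1)) v S (false :: mn) t c mk) =
      some (cfg M (some (Sum.inr Ctrl.pr2f)) v S mn t c mk) := by
  rw [cfg, step_inr]; simp [ctrlStmt, rst, bget, cfg]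

/-- `pr2t` on `true`: the data bit `1` goes to `TMP`. [folklore] -/
theorem step_pr2t_true :
    (loopTM M eIn eOut).step (cfg M (some (Sum.inr Ctrl.pr2t)) v S (true :: mn) t c mk) =
      some (cfg M (some (Sum.inr Ctrl.pr1)) v S mn (true :: t) c mk) := by
  rw [cfg, step_inr]; simp [ctrlStmt, rst, bget, cfg]

/-- `pr2f` on `false`: the data bit `0` goes to `TMP`. [folklore] -/
theorem step_pr2f_false :
    (loopTM M eIn eOut).step (cfg M (some (Sum.inr Ctrl.pr2f)) v S (false :: mn) t c mk) =
      some (cfg M (some (Sum.inr Ctrl.pr1)) v S mn (false :: t) c mk) := by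
  rw [cfg, step_inr]; simp [ctrlStmt, rst, bget, cfg]

/-- `pr2f` on `true`: the separator `01`, proceed to `ld`. [folklore] -/
theorem step_pr2f_true :
    (loopTM M eIn eOut).step (cfg M (some (Sum.inr Ctrl.pr2f)) v S (true :: mn) t c mk) =
      some (cfg M (some (Sum.inr Ctrl.ld)) v S mn t c mk) := by
  rw [cfg, step_inr]; simp [ctrlStmt, rst, bget, cfg]

/-- `test` on the flag `true`: halt via `fin`. [folklore] -/
theorem step_test_true :
    (loopTM M eIn eOut).step (cfg M (some (Sum.inr Ctrl.test)) v S (true :: mn) t c mk) =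
      some (cfg M (some (Sum.inr Ctrl.fin)) v S mn t c mk) := by
  rw [cfg, step_inr]; simp [ctrlStmt, rst, bget, cfg]

/-- `test` on the flag `false`: a round, proceed to `rd1`. [folklore] -/
theorem step_test_false :
    (loopTM M eIn eOut).step (cfg M (some (Sum.inr Ctrl.test)) v S (false :: mn) t c mk) =
      some (cfg M (some (Sum.inr Ctrl.rd1)) v S mn t c mk) := by
  rw [cfg, step_inr]; simp [ctrlStmt, rst, bget, cfg]

/-- `rd1` on a first bit `true`. [folklore] -/
theorem step_rd1_true :
    (loopTM M eIn eOut).step (cfg M (some (Sum.inr Ctrl.rd1)) v S (true :: mn) t c mk) =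
      some (cfg M (some (Sum.inr Ctrl.rd2t)) v S mn t c mk) := by
  rw [cfg, step_inr]; simp [ctrlStmt, rst, bget, cfg]

/-- `rd1` on a first bit `false`. [folklore] -/
theorem step_rd1_false :
    (loopTM M eIn eOut).step (cfg M (some (Sum.inr Ctrl.rd1)) v S (false :: mn) t c mk) =
      some (cfg M (some (Sum.inr Ctrl.rd2f)) v S mn t c mk) := by
  rw [cfg, step_inr]; simp [ctrlStmt, rst, bget, cfg]

/-- `rd2t` on a second bit `true`: digit `1`. [folklore] -/
theorem step_rd2t_true :
    (loopTM M eIn eOut).step (cfg M (some (Sum.inr Ctrl.rd2t)) v S (true :: mn) t c mk) =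
      some (cfg M (some (Sum.inr Ctrl.rd1)) v S mn t (true :: c) mk) := by
  rw [cfg, step_inr]; simp [ctrlStmt, rst, bget, cfg]

/-- `rd2f` on a second bit `false`: digit `0`. [folklore] -/
theorem step_rd2f_false :
    (loopTM M eIn eOut).step (cfg M (some (Sum.inr Ctrl.rd2f)) v S (false :: mn) t c mk) =
      some (cfg M (some (Sum.inr Ctrl.rd1)) v S mn t (false :: c) mk) := by
  rw [cfg, step_inr]; simp [ctrlStmt, rst, bget, cfg]

/-- `rd2f` on a second bit `true`: the separator `01`, start the countdown. [folklore] -/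
theorem step_rd2f_true :
    (loopTM M eIn eOut).step (cfg M (some (Sum.inr Ctrl.rd2f)) v S (true :: mn) t c mk) =
      some (cfg M (some (Sum.inr Ctrl.dec)) v S mn t c mk) := by
  rw [cfg, step_inr]; simp [ctrlStmt, rst, bget, cfg]

/-- `dec` on a low-order `0`: pop it and leave a marker. [folklore] -/
theorem step_dec_false :
    (loopTM M eIn eOut).step (cfg M (some (Sum.inr Ctrl.dec)) v S mn t (false :: c) mk) =
      some (cfg M (some (Sum.inr Ctrl.dec)) v S mn t c (() :: mk)) := by
  rw [cfg, step_inr]; simp [ctrlStmt, rst, bget, cfg]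

/-- `dec` on the lowest `1`: it becomes `0`, proceed to the refill. [folklore] -/
theorem step_dec_true :
    (loopTM M eIn eOut).step (cfg M (some (Sum.inr Ctrl.dec)) v S mn t (true :: c) mk) =
      some (cfg M (some (Sum.inr Ctrl.rf)) v S mn t (false :: c) mk) := by
  rw [cfg, step_inr]; simp [ctrlStmt, rst, bget, cfg]

/-- `dec` on an exhausted counter. [folklore] -/
theorem step_dec_nil :
    (loopTM M eIn eOut).step (cfg M (some (Sum.inr Ctrl.dec)) v S mn t [] mk) =
      some (cfg M (some (Sum.inr Ctrl.cln)) v S mn t [] mk) := by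
  rw [cfg, step_inr]; simp [ctrlStmt, rst, cfg]

/-- `rf` on a marker: refill one `1`. [folklore] -/
theorem step_rf_cons (u : Unit) :
    (loopTM M eIn eOut).step (cfg M (some (Sum.inr Ctrl.rf)) v S mn t c (u :: mk)) =
      some (cfg M (some (Sum.inr Ctrl.rf)) v S mn t (true :: c) mk) := by
  rw [cfg, step_inr]; simp [ctrlStmt, rst, cfg]

/-- `rf` with no marker left. [folklore] -/
theorem step_rf_nil :
    (loopTM M eIn eOut).step (cfg M (some (Sum.inr Ctrl.rf)) v S mn t c []) =
      some (cfg M (some (Sum.inr Ctrl.mv)) v S mn t c []) := by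
  rw [cfg, step_inr]; simp [ctrlStmt, rst, cfg]

/-- `mv`: move one symbol from `MAIN` to `TMP`. [folklore] -/
theorem step_mv_cons (b : Bool) :
    (loopTM M eIn eOut).step (cfg M (some (Sum.inr Ctrl.mv)) v S (b :: mn) t c mk) =
      some (cfg M (some (Sum.inr Ctrl.dec)) v S mn (b :: t) c mk) := by
  rw [cfg, step_inr]; cases b <;> simp [ctrlStmt, rst, bget, cfg]

/-- `cln` on a marker. [folklore] -/
theorem step_cln_cons (u : Unit) :
    (loopTM M eIn eOut).step (cfg M (some (Sum.inr Ctrl.cln)) v S mn t c (u :: mk)) =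
      some (cfg M (some (Sum.inr Ctrl.cln)) v S mn t c mk) := by
  rw [cfg, step_inr]; simp [ctrlStmt, rst, cfg]

/-- `cln` with no marker left. [folklore] -/
theorem step_cln_nil :
    (loopTM M eIn eOut).step (cfg M (some (Sum.inr Ctrl.cln)) v S mn t c []) =
      some (cfg M (some (Sum.inr Ctrl.ld)) v S mn t c []) := by
  rw [cfg, step_inr]; simp [ctrlStmt, rst, cfg]

/-- `ld` on nonempty `TMP`. [folklore] -/
theorem step_ld_cons (b : Bool) :
    (loopTM M eIn eOut).step (cfg M (some (Sum.inr Ctrl.ld)) v S mn (b :: t) c mk) =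
      some (cfg M (some (Sum.inr Ctrl.ld)) v (update S M.k₀ (eIn.symm b :: S M.k₀)) mn t c mk) := by
  rw [cfg, step_inr]; cases b <;> simp [ctrlStmt, rst, bget, cfg]

/-- `ld` on empty `TMP`: jump to the main label of `M`. [folklore] -/
theorem step_ld_nil :
    (loopTM M eIn eOut).step (cfg M (some (Sum.inr Ctrl.ld)) v S mn [] c mk) =
      some (cfg M (some (Sum.inl M.main)) v S mn [] c mk) := by
  rw [cfg, step_inr]; simp [ctrlStmt, rst, cfg]

/-- `out1` on nonempty `k₁`. [folklore] -/
theorem step_out1_cons (g : M.Γ M.k₁) (L : List (M.Γ M.k₁)) :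
    (loopTM M eIn eOut).step
        (cfg M (some (Sum.inr Ctrl.out1)) v (update S M.k₁ (g :: L)) mn t c mk) =
      some (cfg M (some (Sum.inr Ctrl.out1)) v (update S M.k₁ L) mn (eOut g :: t) c mk) := by
  rw [cfg, step_inr]; simp [ctrlStmt, rst, bget, cfg]

/-- `out1` on empty `k₁`. [folklore] -/
theorem step_out1_nil :
    (loopTM M eIn eOut).step (cfg M (some (Sum.inr Ctrl.out1)) v (update S M.k₁ []) mn t c mk) =
      some (cfg M (some (Sum.inr Ctrl.out2)) v (update S M.k₁ []) mn t c mk) := by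
  rw [cfg, step_inr]; simp [ctrlStmt, rst, cfg]

/-- `out2` on nonempty `TMP`. [folklore] -/
theorem step_out2_cons (b : Bool) :
    (loopTM M eIn eOut).step (cfg M (some (Sum.inr Ctrl.out2)) v S mn (b :: t) c mk) =
      some (cfg M (some (Sum.inr Ctrl.out2)) v S (b :: mn) t c mk) := by
  rw [cfg, step_inr]; cases b <;> simp [ctrlStmt, rst, bget, cfg]

/-- `out2` on empty `TMP`: proceed to `test`. [folklore] -/
theorem step_out2_nil :
    (loopTM M eIn eOut).step (cfg M (some (Sum.inr Ctrl.out2)) v S mn [] c mk) =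
      some (cfg M (some (Sum.inr Ctrl.test)) v S mn [] c mk) := by
  rw [cfg, step_inr]; simp [ctrlStmt, rst, cfg]

/-- `fin`: reset the state and halt. [folklore] -/
theorem step_fin :
    (loopTM M eIn eOut).step (cfg M (some (Sum.inr Ctrl.fin)) v S mn t c mk) =
      some (cfg M none M.initialState S mn t c mk) := by
  rw [cfg, step_inr]; simp [ctrlStmt, cfg]

/-- A step of `M` is a step of the loop machine on the embedded configuration. [folklore] -/
theorem step_cfgM (a b : M.Cfg) (h : M.step a = some b) (mn : List Bool) :
    (loopTM M eIn eOut).step (cfgM a mn) = some (cfgM b mn) := by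
  obtain ⟨_ | l, w, S'⟩ := a
  · simp [FinTM2.step, TM2.step] at h
  · simp only [FinTM2.step, TM2.step] at h
    obtain rfl := Option.some.inj h
    simp only [cfgM, Option.elim]
    rw [step_inl, stepAux_trStmt]
    rfl

end Steps

/-! ### Phases -/

section Phases

variable (v : M.σ) (S : ∀ k, List (M.Γ k))

/-- **Prefix, digits**: doubled bits at the head of `MAIN` are pushed (reversed) onto `TMP`.
[folklore] -/
theorem pr_digits (bits : List Bool) (rest t c : List Bool) (mk : List Unit) :
    ReachesIn (C := LCfg M) (loopTM M eIn eOut).step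
      (cfg M (some (Sum.inr Ctrl.pr1)) v S ((bits.flatMap fun b => [b, b]) ++ rest) t c mk)
      (cfg M (some (Sum.inr Ctrl.pr1)) v S rest (bits.reverse ++ t) c mk) (2 * bits.length) := by
  induction bits generalizing t with
  | nil => simpa using ReachesIn.refl _ _
  | cons b bits ih =>
    rw [List.flatMap_cons, List.append_assoc, List.length_cons, Nat.mul_succ, Nat.add_comm,
      List.reverse_cons, List.append_assoc, List.singleton_append]
    cases b
    · have h1 := ReachesIn.single (step_pr1_false M eIn eOut v S
        (false :: ((bits.flatMap fun b => [b, b]) ++ rest)) t c mk)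
      have h2 := ReachesIn.single (step_pr2f_false M eIn eOut v S
        ((bits.flatMap fun b => [b, b]) ++ rest) t c mk)
      simpa [Nat.add_comm] using (h1.trans h2).trans (ih (false :: t))
    · have h1 := ReachesIn.single (step_pr1_true M eIn eOut v S
        (true :: ((bits.flatMap fun b => [b, b]) ++ rest)) t c mk)
      have h2 := ReachesIn.single (step_pr2t_true M eIn eOut v S
        ((bits.flatMap fun b => [b, b]) ++ rest) t c mk)
      simpa [Nat.add_comm] using (h1.trans h2).trans (ih (true :: t))

/-- **Prefix**: reading `boolPair s σ` leaves `s` reversed on `TMP` and `σ` on `MAIN`, at label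
`ld`, after `2|s| + 2` steps. [folklore] -/
theorem pr_run (s σ : List Bool) (c : List Bool) (mk : List Unit) :
    ReachesIn (C := LCfg M) (loopTM M eIn eOut).step
      (cfg M (some (Sum.inr Ctrl.pr1)) v S (boolPair s σ) [] c mk)
      (cfg M (some (Sum.inr Ctrl.ld)) v S σ s.reverse c mk) (2 * s.length + 2) := by
  have e : boolPair s σ = (s.flatMap fun b => [b, b]) ++ ([false, true] ++ σ) := by
    simp [boolPair]
  rw [e]
  have h1 := pr_digits M eIn eOut v S s ([false, true] ++ σ) [] c mk
  rw [List.append_nil] at h1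
  have h2 := ReachesIn.single (step_pr1_false M eIn eOut v S (true :: σ) s.reverse c mk)
  have h3 := ReachesIn.single (step_pr2f_true M eIn eOut v S σ s.reverse c mk)
  exact (h1.trans h2).trans h3

/-- **Header, digits**: doubled bits at the head of `MAIN` are pushed (reversed) onto `CNT`.
[folklore] -/
theorem hdr_digits (bits : List Bool) (rest t c : List Bool) (mk : List Unit) :
    ReachesIn (C := LCfg M) (loopTM M eIn eOut).step
      (cfg M (some (Sum.inr Ctrl.rd1)) v S ((bits.flatMap fun b => [b, b]) ++ rest) t c mk)
      (cfg M (some (Sum.inr Ctrl.rd1)) v S rest t (bits.reverse ++ c) mk) (2 * bits.length) := by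
  induction bits generalizing c with
  | nil => simpa using ReachesIn.refl _ _
  | cons b bits ih =>
    rw [List.flatMap_cons, List.append_assoc, List.length_cons, Nat.mul_succ, Nat.add_comm,
      List.reverse_cons, List.append_assoc, List.singleton_append]
    cases b
    · have h1 := ReachesIn.single (step_rd1_false M eIn eOut v S
        (false :: ((bits.flatMap fun b => [b, b]) ++ rest)) t c mk)
      have h2 := ReachesIn.single (step_rd2f_false M eIn eOut v S
        ((bits.flatMap fun b => [b, b]) ++ rest) t c mk)
      simpa [Nat.add_comm] using (h1.trans h2).trans (ih (false :: c))
    · have h1 := ReachesIn.single (step_rd1_true M eIn eOut v S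
        (true :: ((bits.flatMap fun b => [b, b]) ++ rest)) t c mk)
      have h2 := ReachesIn.single (step_rd2t_true M eIn eOut v S
        ((bits.flatMap fun b => [b, b]) ++ rest) t c mk)
      simpa [Nat.add_comm] using (h1.trans h2).trans (ih (true :: c))

/-- **Header**: reading `passHdr n ++ rest` leaves `encodeNat n` on `CNT` and `rest` on
`MAIN`, at label `dec`, after `|passHdr n|` steps. [folklore] -/
theorem hdr_run (n : ℕ) (rest t : List Bool) (mk : List Unit) :
    ReachesIn (C := LCfg M) (loopTM M eIn eOut).step
      (cfg M (some (Sum.inr Ctrl.rd1)) v S (passHdr n ++ rest) t [] mk)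
      (cfg M (some (Sum.inr Ctrl.dec)) v S rest t (encodeNat n) mk) (passHdr n).length := by
  have e : passHdr n ++ rest =
      ((encodeNat n).reverse.flatMap fun b => [b, b]) ++ ([false, true] ++ rest) := by
    simp [passHdr]
  rw [e, length_passHdr]
  have h1 := hdr_digits M eIn eOut v S (encodeNat n).reverse ([false, true] ++ rest) t [] mk
  rw [List.reverse_reverse, List.append_nil, List.length_reverse] at h1
  have h2 := ReachesIn.single (step_rd1_false M eIn eOut v S (true :: rest) t (encodeNat n) mk)
  have h3 := ReachesIn.single (step_rd2f_true M eIn eOut v S rest t (encodeNat n) mk)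
  exact (h1.trans h2).trans h3

/-- `dec` pops `k` low-order zeros, leaving `k` markers. [folklore] -/
theorem dec_zeros (k : ℕ) (mn t c : List Bool) (mk : List Unit) :
    ReachesIn (C := LCfg M) (loopTM M eIn eOut).step
      (cfg M (some (Sum.inr Ctrl.dec)) v S mn t (List.replicate k false ++ c) mk)
      (cfg M (some (Sum.inr Ctrl.dec)) v S mn t c (List.replicate k () ++ mk)) k := by
  induction k generalizing mk with
  | zero => simpa using ReachesIn.refl _ _
  | succ k ih =>
    have e : List.replicate (k + 1) () ++ mk = List.replicate k () ++ (() :: mk) := by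
      rw [List.replicate_succ', List.append_assoc, List.singleton_append]
    rw [e, List.replicate_succ, List.cons_append]
    exact ReachesIn.step_trans (step_dec_false M eIn eOut v S mn t _ mk) (ih (() :: mk))

/-- `rf` turns `k` markers into `k` low-order ones and proceeds to `mv`. [folklore] -/
theorem rf_run (k : ℕ) (mn t c : List Bool) :
    ReachesIn (C := LCfg M) (loopTM M eIn eOut).step
      (cfg M (some (Sum.inr Ctrl.rf)) v S mn t c (List.replicate k ()))
      (cfg M (some (Sum.inr Ctrl.mv)) v S mn t (List.replicate k true ++ c) []) (k + 1) := by
  induction k generalizing c with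
  | zero => simpa using ReachesIn.single (step_rf_nil M eIn eOut v S mn t c)
  | succ k ih =>
    have e : List.replicate (k + 1) true ++ c = List.replicate k true ++ (true :: c) := by
      rw [List.replicate_succ', List.append_assoc, List.singleton_append]
    rw [e, List.replicate_succ]
    exact ReachesIn.step_trans (step_rf_cons M eIn eOut v S mn t c (List.replicate k ()) ()) (ih (true :: c))

/-- `cln` discards `k` markers and proceeds to `ld`. [folklore] -/
theorem cln_run (k : ℕ) (mn t c : List Bool) :
    ReachesIn (C := LCfg M) (loopTM M eIn eOut).step
      (cfg M (some (Sum.inr Ctrl.cln)) v S mn t c (List.replicate k ()))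
      (cfg M (some (Sum.inr Ctrl.ld)) v S mn t c []) (k + 1) := by
  induction k with
  | zero => simpa using ReachesIn.single (step_cln_nil M eIn eOut v S mn t c)
  | succ k ih =>
    rw [List.replicate_succ]
    exact ReachesIn.step_trans (step_cln_cons M eIn eOut v S mn t c _ ()) ih

/-- **One decrement-and-move**. [folklore] -/
theorem dec_once (k : ℕ) (c' : List Bool) (b : Bool) (mn t : List Bool) :
    ReachesIn (C := LCfg M) (loopTM M eIn eOut).step
      (cfg M (some (Sum.inr Ctrl.dec)) v S (b :: mn) t (List.replicate k false ++ true :: c') [])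
      (cfg M (some (Sum.inr Ctrl.dec)) v S mn (b :: t) (List.replicate k true ++ false :: c') [])
      (2 * k + 3) := by
  have h1 := dec_zeros M eIn eOut v S k (b :: mn) t (true :: c') []
  rw [List.append_nil] at h1
  have h2 := ReachesIn.single (step_dec_true M eIn eOut v S (b :: mn) t c' (List.replicate k ()))
  have h3 := rf_run M eIn eOut v S k (b :: mn) t (false :: c')
  have h4 := ReachesIn.single (step_mv_cons M eIn eOut v S mn t
    (List.replicate k true ++ false :: c') [] b)
  exact (((h1.trans h2).trans h3).trans h4).mono (by omega)

/-- **Exhausted counter**. [folklore] -/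
theorem dec_exhaust (k : ℕ) (mn t : List Bool) :
    ReachesIn (C := LCfg M) (loopTM M eIn eOut).step
      (cfg M (some (Sum.inr Ctrl.dec)) v S mn t (List.replicate k false) [])
      (cfg M (some (Sum.inr Ctrl.ld)) v S mn t [] []) (2 * k + 2) := by
  have h1 := dec_zeros M eIn eOut v S k mn t [] []
  rw [List.append_nil, List.append_nil] at h1
  have h2 := ReachesIn.single (step_dec_nil M eIn eOut v S mn t (List.replicate k ()))
  have h3 := cln_run M eIn eOut v S k mn t []
  exact ((h1.trans h2).trans h3).mono (by omega)

/-- **The countdown** (as in `TM2PassThrough.lean`). [cite: AroraBarakCC2009, §1.3] -/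
theorem countdown (B : ℕ) : ∀ (m : ℕ) (c : List Bool), bitsToNat c = m → c.length ≤ B →
    ∀ (l mn t : List Bool), l.length = m →
    ReachesIn (C := LCfg M) (loopTM M eIn eOut).step
      (cfg M (some (Sum.inr Ctrl.dec)) v S (l ++ mn) t c [])
      (cfg M (some (Sum.inr Ctrl.ld)) v S mn (l.reverse ++ t) [] []) (m * (2 * B + 3) + 2 * B + 2)
  | 0, c, hc, hB, l, mn, t, hl => by
    obtain rfl : l = [] := List.eq_nil_of_length_eq_zero hl
    rw [eq_replicate_of_bitsToNat_eq_zero hc]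
    refine (dec_exhaust M eIn eOut v S c.length mn t).mono ?_
    omega
  | m + 1, c, hc, hB, l, mn, t, hl => by
    obtain ⟨b, l, rfl⟩ : ∃ b l', l = b :: l' := by
      cases l with
      | nil => simp at hl
      | cons b l' => exact ⟨b, l', rfl⟩
    obtain ⟨k, c', rfl⟩ := exists_split_of_bitsToNat_pos (c := c) (by omega)
    have hval : bitsToNat (List.replicate k true ++ false :: c') = m := by
      have := bitsToNat_decrement k c'; omega
    have hlen : (List.replicate k true ++ false :: c').length ≤ B := by simpa using hB
    have hk : 2 * k + 3 ≤ 2 * B + 3 := by simp at hB; omega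
    have h1 := dec_once M eIn eOut v S k c' b (l ++ mn) t
    have h2 := countdown B m _ hval hlen l mn (b :: t) (by simpa using hl)
    rw [List.cons_append, List.reverse_cons, List.append_assoc, List.singleton_append]
    refine (h1.trans h2).mono ?_
    have e3 : (m + 1) * (2 * B + 3) = m * (2 * B + 3) + (2 * B + 3) := by ring
    omega

/-- `ld`: `TMP` is moved (reversed, through `eIn.symm`) on top of `k₀`, then jump to `M`.
[folklore] -/
theorem ld_run (mn t c : List Bool) (mk : List Unit) :
    ReachesIn (C := LCfg M) (loopTM M eIn eOut).step
      (cfg M (some (Sum.inr Ctrl.ld)) v S mn t c mk)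
      (cfg M (some (Sum.inl M.main)) v (update S M.k₀ (t.reverse.map eIn.symm ++ S M.k₀)) mn [] c mk)
      (t.length + 1) := by
  induction t generalizing S with
  | nil => simpa using ReachesIn.single (step_ld_nil M eIn eOut v S mn c mk)
  | cons b t ih =>
    have := ih (update S M.k₀ (eIn.symm b :: S M.k₀))
    rw [update_idem, update_self] at this
    simpa [List.append_assoc] using
      ReachesIn.step_trans (step_ld_cons M eIn eOut v S mn t c mk b) this

/-- `out1`: `k₁` is moved (reversed, through `eOut`) onto `TMP`, then `out2`. [folklore] -/
theorem out1_run (L : List (M.Γ M.k₁)) (mn t c : List Bool) (mk : List Unit) :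
    ReachesIn (C := LCfg M) (loopTM M eIn eOut).step
      (cfg M (some (Sum.inr Ctrl.out1)) v (update S M.k₁ L) mn t c mk)
      (cfg M (some (Sum.inr Ctrl.out2)) v (update S M.k₁ []) mn (L.reverse.map eOut ++ t) c mk)
      (L.length + 1) := by
  induction L generalizing t with
  | nil => simpa using ReachesIn.single (step_out1_nil M eIn eOut v S mn t c mk)
  | cons g L ih =>
    simpa [List.append_assoc] using
      ReachesIn.step_trans (step_out1_cons M eIn eOut v S mn t c mk g L) (ih (eOut g :: t))

/-- `out2`: `TMP` is moved (reversed) on top of `MAIN`, then `test`. [folklore] -/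
theorem out2_run (mn t c : List Bool) (mk : List Unit) :
    ReachesIn (C := LCfg M) (loopTM M eIn eOut).step
      (cfg M (some (Sum.inr Ctrl.out2)) v S mn t c mk)
      (cfg M (some (Sum.inr Ctrl.test)) v S (t.reverse ++ mn) [] c mk) (t.length + 1) := by
  induction t generalizing mn with
  | nil => simpa using ReachesIn.single (step_out2_nil M eIn eOut v S mn c mk)
  | cons b t ih =>
    simpa [List.append_assoc] using
      ReachesIn.step_trans (step_out2_cons M eIn eOut v S mn t c mk b) (ih (b :: mn))

/-- A run of `M` is a run of the loop machine on embedded configurations. [folklore] -/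
theorem run_cfgM {n : ℕ} {a b : M.Cfg} (h : (flip bind M.step)^[n] (some a) = some b)
    (mn : List Bool) :
    (flip bind (loopTM M eIn eOut).step)^[n] (some (cfgM a mn)) = some (cfgM b mn) :=
  iterate_bind_map M.step (loopTM M eIn eOut).step (fun x => cfgM x mn)
    (fun x y hxy => step_cfgM M eIn eOut x y hxy mn) n a b h

/-- The initial configuration of the loop machine. [folklore] -/
theorem initList_loopTM (l : List Bool) :
    initList (loopTM M eIn eOut) l =
      cfg M (some (Sum.inr Ctrl.pr1)) M.initialState (fun _ => []) l [] [] [] := by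
  rw [initList_eq]
  change (⟨some (Sum.inr Ctrl.pr1), (M.initialState, none),
      update (fun j => ([] : List (PassΓ M.Γ j))) (Sum.inr Aux.MAIN) l⟩ :
      TM2.Cfg (PassΓ M.Γ) (M.Λ ⊕ Ctrl) (St M.σ)) = _
  rw [← mkStk_bot_MAIN]
  rfl

/-- The halting configuration of the loop machine. [folklore] -/
theorem haltList_loopTM (l : List Bool) :
    haltList (loopTM M eIn eOut) l = cfg M none M.initialState (fun _ => []) l [] [] [] := by
  rw [haltList_eq]
  change (⟨none, (M.initialState, none),
      update (fun j => ([] : List (PassΓ M.Γ j))) (Sum.inr Aux.MAIN) l⟩ :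
      TM2.Cfg (PassΓ M.Γ) (M.Λ ⊕ Ctrl) (St M.σ)) = _
  rw [← mkStk_bot_MAIN]
  rfl

/-- The embedded initial configuration of `M` on input `l`, above the suffix `mn`. [folklore] -/
theorem cfgM_initList (l : List (M.Γ M.k₀)) (mn : List Bool) :
    cfgM (initList M l) mn =
      cfg M (some (Sum.inl M.main)) M.initialState (update (fun _ => []) M.k₀ l) mn [] [] [] := by
  rw [initList_eq]; rfl

/-- The embedded halting configuration of `M` with output `L`, above the suffix `mn`.
[folklore] -/
theorem cfgM_haltList (L : List (M.Γ M.k₁)) (mn : List Bool) :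
    cfgM (haltList M L) mn =
      cfg M (some (Sum.inr Ctrl.out1)) M.initialState (update (fun _ => []) M.k₁ L) mn [] [] [] := by
  rw [haltList_eq]; rfl

end Phases

end Bundled

/-! ### The coin loop computes the orbit -/

section Main

variable (Mx : TM2ComputableAux Bool Bool) (p : Polynomial ℕ) {F : List Bool → List Bool}
  (hF : ∀ a, Mx.OutputsWithin a (F a) (p.eval a.length))

/-- The coin-loop machine of `Mx : TM2ComputableAux Bool Bool`, as a machine with input and
output alphabet `Bool` (one stack serving as both). [folklore] -/
noncomputable def loopAux : TM2ComputableAux Bool Bool :=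
  ⟨loopTM Mx.tm Mx.inputAlphabet Mx.outputAlphabet, Equiv.refl _, Equiv.refl _⟩

/-- The cost of the initial phase in terms of `|x|`: `5N + 6 + (2D + 1) p(N)`. [folklore] -/
noncomputable def initPoly (p : Polynomial ℕ) (D : ℕ) : Polynomial ℕ :=
  5 * Polynomial.X + 6 + Polynomial.C (2 * D + 1) * p

/-- Evaluation of `initPoly`. [folklore] -/
theorem initPoly_eval (p : Polynomial ℕ) (D N : ℕ) :
    (initPoly p D).eval N = 5 * N + 6 + (2 * D + 1) * p.eval N := by
  simp [initPoly]

include hF in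
/-- **Running `M` from `ld`.** From `ld` with `TMP = s.reverse` (the input of `M`, reversed), the
loop machine reaches `test` with `MAIN = F s ++ mn` within `|s| + 1 + p |s| + 2 (|F s| + 1)`
steps. [cite: AroraBarak2009, §1.3] -/
theorem ld_to_test (s mn : List Bool) :
    ReachesIn (C := LCfg Mx.tm) (loopTM Mx.tm Mx.inputAlphabet Mx.outputAlphabet).step
      (cfg Mx.tm (some (Sum.inr Ctrl.ld)) Mx.tm.initialState (fun _ => []) mn s.reverse [] [])
      (cfg Mx.tm (some (Sum.inr Ctrl.test)) Mx.tm.initialState (fun _ => []) (F s ++ mn) [] [] [])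
      (s.length + 1 + p.eval s.length + 2 * ((F s).length + 1)) := by
  -- load `s` onto the input stack of `M`
  have h3 := ld_run Mx.tm Mx.inputAlphabet Mx.outputAlphabet Mx.tm.initialState (fun _ => [])
    mn s.reverse [] []
  rw [List.reverse_reverse, List.length_reverse, List.append_nil, ← cfgM_initList] at h3
  -- run `M`
  have h4 : ReachesIn (C := LCfg Mx.tm) (loopTM Mx.tm Mx.inputAlphabet Mx.outputAlphabet).step
      (cfgM (initList Mx.tm (s.map Mx.inputAlphabet.symm)) mn)
      (cfgM (haltList Mx.tm ((F s).map Mx.outputAlphabet.symm)) mn) (p.eval s.length) := by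
    obtain ⟨k, hk, e⟩ := reachesIn_of_outputsWithin Mx (hF s)
    exact ⟨k, hk, run_cfgM Mx.tm Mx.inputAlphabet Mx.outputAlphabet e mn⟩
  rw [cfgM_haltList] at h4
  -- unload the output of `M`
  have h5 := out1_run Mx.tm Mx.inputAlphabet Mx.outputAlphabet Mx.tm.initialState (fun _ => [])
    ((F s).map Mx.outputAlphabet.symm) mn [] [] []
  have e5 : ((F s).map Mx.outputAlphabet.symm).reverse.map Mx.outputAlphabet ++ [] =
      (F s).reverse := by simp [List.map_reverse]
  have e6 : update (fun k : Mx.tm.K => ([] : List (Mx.tm.Γ k))) Mx.tm.k₁ [] = fun k => [] :=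
    update_eq_self Mx.tm.k₁ (fun k : Mx.tm.K => ([] : List (Mx.tm.Γ k)))
  rw [e5, List.length_map, e6] at h5
  have h6 := out2_run Mx.tm Mx.inputAlphabet Mx.outputAlphabet Mx.tm.initialState (fun _ => [])
    mn (F s).reverse [] []
  rw [List.reverse_reverse, List.length_reverse] at h6
  exact (((h3.trans h4).trans h5).trans h6).mono (by omega)

include hF in
/-- **The initial phase.** On input `boolPair x σ` the loop machine reaches `test` with
`MAIN = F x ++ σ` within `initPoly p D |x|` steps. [cite: AroraBarak2009, §1.3] -/
theorem init_run (x σ : List Bool) :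
    ReachesIn (C := LCfg Mx.tm) (loopTM Mx.tm Mx.inputAlphabet Mx.outputAlphabet).step
      (cfg Mx.tm (some (Sum.inr Ctrl.pr1)) Mx.tm.initialState (fun _ => []) (boolPair x σ) [] [] [])
      (cfg Mx.tm (some (Sum.inr Ctrl.test)) Mx.tm.initialState (fun _ => []) (F x ++ σ) [] [] [])
      ((initPoly p (machinePushBound Mx.tm)).eval x.length) := by
  have h1 := pr_run Mx.tm Mx.inputAlphabet Mx.outputAlphabet Mx.tm.initialState (fun _ => [])
    x σ [] []
  have h2 := ld_to_test Mx p hF x σ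
  refine (h1.trans h2).mono ?_
  have hFx : (F x).length ≤ x.length + machinePushBound Mx.tm * p.eval x.length := (hF x).length_le
  rw [initPoly_eval]
  set D := machinePushBound Mx.tm
  have : (2 * D + 1) * p.eval x.length = 2 * (D * p.eval x.length) + p.eval x.length := by ring
  omega

include hF in
/-- **One round.** From `test` with `MAIN = false :: passHdr |s| ++ s ++ σ` the loop machine
reaches `test` with `MAIN = F s ++ σ` within `passPoly p D |s| + 1` steps.
[cite: AroraBarak2009, §7.4.1 (one repetition) and §1.3] -/
theorem round_run (s σ : List Bool) :
    ReachesIn (C := LCfg Mx.tm) (loopTM Mx.tm Mx.inputAlphabet Mx.outputAlphabet).step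
      (cfg Mx.tm (some (Sum.inr Ctrl.test)) Mx.tm.initialState (fun _ => [])
        (false :: (passHdr s.length ++ s ++ σ)) [] [] [])
      (cfg Mx.tm (some (Sum.inr Ctrl.test)) Mx.tm.initialState (fun _ => []) (F s ++ σ) [] [] [])
      ((passPoly p (machinePushBound Mx.tm)).eval s.length + 1) := by
  set n := s.length with hn
  have h0 := ReachesIn.single (step_test_false Mx.tm Mx.inputAlphabet Mx.outputAlphabet
    Mx.tm.initialState (fun _ => []) (passHdr n ++ s ++ σ) [] [] [])
  -- header
  have h1 := hdr_run Mx.tm Mx.inputAlphabet Mx.outputAlphabet Mx.tm.initialState (fun _ => [])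
    n (s ++ σ) [] []
  rw [← List.append_assoc] at h1
  -- countdown
  have h2 := countdown Mx.tm Mx.inputAlphabet Mx.outputAlphabet Mx.tm.initialState (fun _ => [])
    (n + 1) n (encodeNat n) (bitsToNat_encodeNat n) (length_encodeNat_le_self n) s σ [] hn.symm
  rw [List.append_nil] at h2
  -- run `M` and unload
  have h3 := ld_to_test Mx p hF s σ
  rw [← hn] at h3
  refine (((h0.trans h1).trans h2).trans h3).mono ?_
  have hFs : (F s).length ≤ n + machinePushBound Mx.tm * p.eval n := (hF s).length_le
  have hH : (passHdr n).length ≤ 2 * n + 4 := by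
    rw [length_passHdr]; have := length_encodeNat_le_self n; omega
  rw [passPoly_eval]
  set D := machinePushBound Mx.tm
  have e1 : n * (2 * (n + 1) + 3) = 2 * n ^ 2 + 5 * n := by ring
  have e2 : (2 * D + 1) * p.eval n = 2 * (D * p.eval n) + p.eval n := by ring
  omega

include hF in
/-- **The loop of rounds.** If the inputs `s j = a j ++ c j` of the rounds `j = i, …, J` are
consistent — the coins satisfy `σ j = c j ++ σ (j+1)`, round `j < J` answers
`0 · passHdr |s (j+1)| … a (j+1)`, round `J` answers `1 · y` — then from `test` with
`MAIN = 0 · passHdr |s i| ++ a i ++ σ i` the loop machine halts with `MAIN = y ++ σ (J+1)` within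
`∑_{i ≤ j ≤ J} (passPoly p D |s j| + 1) + 2` steps. [cite: AroraBarak2009, §7.4.1] -/
theorem rounds_run (a c σ : ℕ → List Bool) (J : ℕ) (y : List Bool)
    (hσ : ∀ j ≤ J, σ j = c j ++ σ (j + 1))
    (hcont : ∀ j < J, F (a j ++ c j) =
      false :: (passHdr (a (j + 1) ++ c (j + 1)).length ++ a (j + 1)))
    (hlast : F (a J ++ c J) = true :: y) :
    ∀ d i : ℕ, i + d = J →
    ReachesIn (C := LCfg Mx.tm) (loopTM Mx.tm Mx.inputAlphabet Mx.outputAlphabet).step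
      (cfg Mx.tm (some (Sum.inr Ctrl.test)) Mx.tm.initialState (fun _ => [])
        (false :: (passHdr (a i ++ c i).length ++ a i ++ σ i)) [] [] [])
      (cfg Mx.tm none Mx.tm.initialState (fun _ => []) (y ++ σ (J + 1)) [] [] [])
      ((∑ j ∈ Finset.Ico i (J + 1),
        ((passPoly p (machinePushBound Mx.tm)).eval (a j ++ c j).length + 1)) + 2)
  | 0, i, hi => by
    rw [Nat.add_zero] at hi
    subst hi
    have h1 := round_run Mx p hF (a i ++ c i) (σ (i + 1))
    rw [List.append_assoc, List.append_assoc, ← hσ i le_rfl, hlast] at h1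
    have h2 := ReachesIn.single (step_test_true Mx.tm Mx.inputAlphabet Mx.outputAlphabet
      Mx.tm.initialState (fun _ => []) (y ++ σ (i + 1)) [] [] [])
    have h3 := ReachesIn.single (step_fin Mx.tm Mx.inputAlphabet Mx.outputAlphabet
      Mx.tm.initialState (fun _ => []) (y ++ σ (i + 1)) [] [] [])
    simp only [List.cons_append, List.append_assoc] at h1 h2 h3 ⊢
    refine ((h1.trans h2).trans h3).mono ?_
    rw [Nat.Ico_succ_singleton, Finset.sum_singleton]
  | d + 1, i, hi => by
    have hiJ : i < J := by omega
    have h1 := round_run Mx p hF (a i ++ c i) (σ (i + 1))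
    rw [List.append_assoc, List.append_assoc, ← hσ i hiJ.le, hcont i hiJ] at h1
    have h2 := rounds_run a c σ J y hσ hcont hlast d (i + 1) (by omega)
    simp only [List.cons_append, List.append_assoc] at h1 h2 ⊢
    refine (h1.trans h2).mono ?_
    rw [Finset.sum_eq_sum_Ico_succ_bot (show i < J + 1 by omega)]
    omega

include hF in
/-- **The coin loop.** Let `x` be the instance code and `σ 0 = c 0 ++ c 1 ++ ⋯ ++ c J ++ σ (J+1)`
the coin string (`σ j = c j ++ σ (j+1)`). If `M` answers the instance with
`F x = 0 · passHdr (|a 0| + |c 0|) · a 0`, round `j < J` (input `a j ++ c j`) with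
`0 · passHdr (|a (j+1)| + |c (j+1)|) · a (j+1)`, and round `J` with `1 · y`, then on input
`boolPair x (σ 0)` the loop machine outputs `y ++ σ (J+1)` within
`initPoly p D |x| + ∑_{j ≤ J} (passPoly p D (|a j| + |c j|) + 1) + 2` steps — the sum of the
costs of the rounds, whatever the length of the coins not yet read.
[cite: AroraBarak2009, §7.4.1 (error reduction by repetition: running time = repetitions × cost) with Def. 7.1] -/
theorem loopAux_outputsWithin (x : List Bool) (a c σ : ℕ → List Bool) (J : ℕ) (y : List Bool)
    (hσ : ∀ j ≤ J, σ j = c j ++ σ (j + 1))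
    (h0 : F x = false :: (passHdr (a 0 ++ c 0).length ++ a 0))
    (hcont : ∀ j < J, F (a j ++ c j) =
      false :: (passHdr (a (j + 1) ++ c (j + 1)).length ++ a (j + 1)))
    (hlast : F (a J ++ c J) = true :: y) :
    (loopAux Mx).OutputsWithin (boolPair x (σ 0)) (y ++ σ (J + 1))
      ((initPoly p (machinePushBound Mx.tm)).eval x.length +
        (∑ j ∈ Finset.range (J + 1),
          ((passPoly p (machinePushBound Mx.tm)).eval (a j ++ c j).length + 1)) + 2) := by
  apply outputsWithin_of_reachesIn
  have hin : (boolPair x (σ 0)).map (loopAux Mx).inputAlphabet.symm = boolPair x (σ 0) :=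
    List.map_id _
  have hout : (y ++ σ (J + 1)).map (loopAux Mx).outputAlphabet.symm = y ++ σ (J + 1) :=
    List.map_id _
  rw [hin, hout]
  change ReachesIn (C := LCfg Mx.tm) (loopTM Mx.tm Mx.inputAlphabet Mx.outputAlphabet).step
    (initList (loopTM Mx.tm Mx.inputAlphabet Mx.outputAlphabet) _)
    (haltList (loopTM Mx.tm Mx.inputAlphabet Mx.outputAlphabet) _) _
  rw [initList_loopTM, haltList_loopTM]
  have h1 := init_run Mx p hF x (σ 0)
  rw [h0] at h1
  have h2 := rounds_run Mx p hF a c σ J y hσ hcont hlast J 0 (Nat.zero_add J)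
  rw [Finset.range_eq_Ico]
  simp only [List.cons_append, List.append_assoc] at h1 h2 ⊢
  exact (h1.trans h2).mono (by omega)

end Main

end TM2CoinLoop

end Literature.Computability.Complexity
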